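import Summits.Ventures.PercRepro2.CaseOneA2Edge
import Summits.Ventures.PercRepro2.CaseOneDWorldOdds

/-!
# The `b`-side coefficients of the Q-threshold `(ii)` along an `a₂a₃`-edge (blind cell PercRepro2,
p1 g30; used by `CaseOneA2EdgeQ.lean`)

BHK 1.4 in the cleared form `X₀ P₂ − Y₀ P₁ ≤ 0` (**`bhk14_cleared`**) and at the forced-open `b`-pair
`X₁ P₂ − Y₁ P₁ ≤ 0` (**`bhk14_forced_open`**, from `a2_bThreshold_nonneg`); and the Bernstein
coefficient `Λ(c⁰, y¹)` of `iiExprQ_a2_edge` — the `(ii)` form of `G − e₂` at its own Q-pair with the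
forced-open `b`-pair — is `≥ 0` when `(ii-Q)` holds for `G − e₂`, by
`X₀ · Λ(c⁰, y¹) = X₁ · (ii-Q)(p₀) + (X₀ Y₁ − X₁ Y₀)(Dqo₀ P₁ − X₀ P₃)` with the Q-odds lemma `odds_q`
(**`lamQ_c0_y1_nonneg`**). Own code; standard axioms.
-/

namespace Summit.Ventures.PercRepro2

namespace CaseOne

section QB
variable {V : Type*} {E : Type*} [Fintype E] [DecidableEq E] [Fintype V] [DecidableEq V]
  {R : Type*} [Field R] [LinearOrder R] [IsStrictOrderedRing R]
variable {ends : E → Sym2 V} {a₁ a₂ a₃ : V} {e₂ : E}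

/-- BHK 1.4 for `G − e₂` in the cleared form `X₀ P₂ − Y₀ P₁ ≤ 0`. -/
lemma bhk14_cleared (p : E → R) (hp : IsProbVec p) (b : V) :
    prob p (connEvent ends a₁ a₂)ᶜ *
        prob p (connEvent ends a₂ b ∩ connEvent ends a₁ a₃ ∩ (connEvent ends a₁ a₂)ᶜ) -
      prob p (connEvent ends a₂ b ∩ (connEvent ends a₁ a₂)ᶜ) *
        prob p (connEvent ends a₁ a₃ ∩ (connEvent ends a₁ a₂)ᶜ) ≤ 0 := by
  have hbhk := bhk_cross_cluster p hp ends a₂ a₁ (isUpperSet_mem_setOf b) (isUpperSet_mem_setOf a₃)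
  rw [← connEvent_eq_clusterInEvent ends a₂ b, ← connEvent_eq_clusterInEvent ends a₁ a₃,
    connEvent_comm ends a₂ a₁] at hbhk
  linarith

/-- BHK 1.4 at the forced-open `b`-pair: `X₁ P₂ − Y₁ P₁ ≤ 0`. -/
lemma bhk14_forced_open (p : E → R) (hp : IsProbVec p) (he : ends e₂ = s(a₂, a₃)) (b : V) :
    prob (Function.update p e₂ 1) (connEvent ends a₁ a₂)ᶜ *
        prob (Function.update p e₂ 0) (connEvent ends a₂ b ∩ connEvent ends a₁ a₃ ∩
          (connEvent ends a₁ a₂)ᶜ) -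
      prob (Function.update p e₂ 1) (connEvent ends a₂ b ∩ (connEvent ends a₁ a₂)ᶜ) *
        prob (Function.update p e₂ 0) (connEvent ends a₁ a₃ ∩ (connEvent ends a₁ a₂)ᶜ) ≤ 0 := by
  set p₀ := Function.update p e₂ 0 with hp₀
  set p₁ := Function.update p e₂ 1 with hp₁
  have hp0 : IsProbVec p₀ := hp.update e₂ le_rfl zero_le_one
  have hp1 : IsProbVec p₁ := hp.update e₂ zero_le_one le_rfl
  have h0 := bhk14_cleared (ends := ends) (a₁ := a₁) (a₂ := a₂) (a₃ := a₃) p₀ hp0 b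
  have hsign := a2_bThreshold_nonneg (a₁ := a₁) p hp he b
  have hX0 : 0 ≤ prob p₀ (connEvent ends a₁ a₂)ᶜ := prob_nonneg hp0 _
  have hP1 : 0 ≤ prob p₀ (connEvent ends a₁ a₃ ∩ (connEvent ends a₁ a₂)ᶜ) := prob_nonneg hp0 _
  have hP2 : 0 ≤ prob p₀ (connEvent ends a₂ b ∩ connEvent ends a₁ a₃ ∩ (connEvent ends a₁ a₂)ᶜ) :=
    prob_nonneg hp0 _
  have hY1 : 0 ≤ prob p₁ (connEvent ends a₂ b ∩ (connEvent ends a₁ a₂)ᶜ) := prob_nonneg hp1 _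
  have hX1 : 0 ≤ prob p₁ (connEvent ends a₁ a₂)ᶜ := prob_nonneg hp1 _
  rcases eq_or_lt_of_le hX0 with hX0' | hX0'
  · have hz : prob p₀ (connEvent ends a₂ b ∩ connEvent ends a₁ a₃ ∩ (connEvent ends a₁ a₂)ᶜ) = 0 :=
      le_antisymm (by rw [hX0']; exact prob_mono hp0 (fun _ h => h.2)) hP2
    rw [hz, mul_zero, zero_sub]
    exact neg_nonpos.mpr (mul_nonneg hY1 hP1)
  · -- `X₀ · (X₁ P₂ − Y₁ P₁) = X₁ (X₀ P₂ − Y₀ P₁) − (X₀ Y₁ − X₁ Y₀) P₁ ≤ 0`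
    have key : prob p₀ (connEvent ends a₁ a₂)ᶜ *
        (prob p₁ (connEvent ends a₁ a₂)ᶜ *
          prob p₀ (connEvent ends a₂ b ∩ connEvent ends a₁ a₃ ∩ (connEvent ends a₁ a₂)ᶜ) -
        prob p₁ (connEvent ends a₂ b ∩ (connEvent ends a₁ a₂)ᶜ) *
          prob p₀ (connEvent ends a₁ a₃ ∩ (connEvent ends a₁ a₂)ᶜ)) =
        prob p₁ (connEvent ends a₁ a₂)ᶜ *
          (prob p₀ (connEvent ends a₁ a₂)ᶜ *
            prob p₀ (connEvent ends a₂ b ∩ connEvent ends a₁ a₃ ∩ (connEvent ends a₁ a₂)ᶜ) -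
          prob p₀ (connEvent ends a₂ b ∩ (connEvent ends a₁ a₂)ᶜ) *
            prob p₀ (connEvent ends a₁ a₃ ∩ (connEvent ends a₁ a₂)ᶜ)) -
        (prob p₀ (connEvent ends a₁ a₂)ᶜ * prob p₁ (connEvent ends a₂ b ∩ (connEvent ends a₁ a₂)ᶜ) -
          prob p₁ (connEvent ends a₁ a₂)ᶜ * prob p₀ (connEvent ends a₂ b ∩ (connEvent ends a₁ a₂)ᶜ)) *
        prob p₀ (connEvent ends a₁ a₃ ∩ (connEvent ends a₁ a₂)ᶜ) := by ring
    have h1 := mul_nonpos_of_nonneg_of_nonpos hX1 h0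
    have h2 := mul_nonneg hsign hP1
    have hle : prob p₀ (connEvent ends a₁ a₂)ᶜ *
        (prob p₁ (connEvent ends a₁ a₂)ᶜ *
          prob p₀ (connEvent ends a₂ b ∩ connEvent ends a₁ a₃ ∩ (connEvent ends a₁ a₂)ᶜ) -
        prob p₁ (connEvent ends a₂ b ∩ (connEvent ends a₁ a₂)ᶜ) *
          prob p₀ (connEvent ends a₁ a₃ ∩ (connEvent ends a₁ a₂)ᶜ)) ≤ 0 := by
      rw [key]; linarith
    rcases le_or_gt (prob p₁ (connEvent ends a₁ a₂)ᶜ *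
        prob p₀ (connEvent ends a₂ b ∩ connEvent ends a₁ a₃ ∩ (connEvent ends a₁ a₂)ᶜ) -
      prob p₁ (connEvent ends a₂ b ∩ (connEvent ends a₁ a₂)ᶜ) *
        prob p₀ (connEvent ends a₁ a₃ ∩ (connEvent ends a₁ a₂)ᶜ)) 0 with hfin | hfin
    · exact hfin
    · exfalso
      have := mul_pos hX0' hfin
      linarith

/-- **The coefficient `Λ(c⁰, y¹)` is nonnegative** when `(ii-Q)` holds for `G − e₂`: the
`b`-threshold monotonicity and the Q-odds lemma. -/
theorem lamQ_c0_y1_nonneg (p : E → R) (hp : IsProbVec p) (he : ends e₂ = s(a₂, a₃)) (o b : V)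
    (hQ : ZSplitIIQ (Function.update p e₂ 0) ends o a₁ a₂ a₃ b) :
    0 ≤ prob (Function.update p e₂ 0) (connEvent ends a₁ a₂)ᶜ *
        (prob (Function.update p e₂ 1) (connEvent ends a₁ a₂)ᶜ *
          prob (Function.update p e₂ 0) (connEvent ends a₂ b ∩ connEvent ends a₁ a₃ ∩
            connEvent ends a₂ o ∩ (connEvent ends a₁ a₂)ᶜ) -
        prob (Function.update p e₂ 1) (connEvent ends a₂ b ∩ (connEvent ends a₁ a₂)ᶜ) *
          prob (Function.update p e₂ 0) (connEvent ends a₁ a₃ ∩ connEvent ends a₂ o ∩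
            (connEvent ends a₁ a₂)ᶜ)) -
      Dqo (Function.update p e₂ 0) ends o a₁ a₂ *
        (prob (Function.update p e₂ 1) (connEvent ends a₁ a₂)ᶜ *
          prob (Function.update p e₂ 0) (connEvent ends a₂ b ∩ connEvent ends a₁ a₃ ∩
            (connEvent ends a₁ a₂)ᶜ) -
        prob (Function.update p e₂ 1) (connEvent ends a₂ b ∩ (connEvent ends a₁ a₂)ᶜ) *
          prob (Function.update p e₂ 0) (connEvent ends a₁ a₃ ∩ (connEvent ends a₁ a₂)ᶜ)) := by
  unfold ZSplitIIQ at hQ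
  rw [iiExprT_eq] at hQ
  set p₀ := Function.update p e₂ 0 with hp₀
  set p₁ := Function.update p e₂ 1 with hp₁
  have hp0 : IsProbVec p₀ := hp.update e₂ le_rfl zero_le_one
  have hp1 : IsProbVec p₁ := hp.update e₂ zero_le_one le_rfl
  have hsign := a2_bThreshold_nonneg (a₁ := a₁) p hp he b
  have hodds := odds_q p₀ hp0 ends o a₁ a₂ a₃
  have hX1 : 0 ≤ prob p₁ (connEvent ends a₁ a₂)ᶜ := prob_nonneg hp1 _
  have hX0 : 0 ≤ prob p₀ (connEvent ends a₁ a₂)ᶜ := prob_nonneg hp0 _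
  set T := prob p₀ (connEvent ends a₁ a₂)ᶜ *
        (prob p₁ (connEvent ends a₁ a₂)ᶜ *
          prob p₀ (connEvent ends a₂ b ∩ connEvent ends a₁ a₃ ∩ connEvent ends a₂ o ∩
            (connEvent ends a₁ a₂)ᶜ) -
        prob p₁ (connEvent ends a₂ b ∩ (connEvent ends a₁ a₂)ᶜ) *
          prob p₀ (connEvent ends a₁ a₃ ∩ connEvent ends a₂ o ∩ (connEvent ends a₁ a₂)ᶜ)) -
      Dqo p₀ ends o a₁ a₂ *
        (prob p₁ (connEvent ends a₁ a₂)ᶜ *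
          prob p₀ (connEvent ends a₂ b ∩ connEvent ends a₁ a₃ ∩ (connEvent ends a₁ a₂)ᶜ) -
        prob p₁ (connEvent ends a₂ b ∩ (connEvent ends a₁ a₂)ᶜ) *
          prob p₀ (connEvent ends a₁ a₃ ∩ (connEvent ends a₁ a₂)ᶜ)) with hT
  -- `X₀ · T = X₁ · (ii-Q)(p₀) + (X₀ Y₁ − X₁ Y₀)(Dqo₀ P₁ − X₀ P₃)`
  have key : prob p₀ (connEvent ends a₁ a₂)ᶜ * T =
      prob p₁ (connEvent ends a₁ a₂)ᶜ *
        (prob p₀ (connEvent ends a₁ a₂)ᶜ *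
          (prob p₀ (connEvent ends a₁ a₂)ᶜ *
            prob p₀ (connEvent ends a₂ b ∩ connEvent ends a₁ a₃ ∩ connEvent ends a₂ o ∩
              (connEvent ends a₁ a₂)ᶜ) -
          prob p₀ (connEvent ends a₂ b ∩ (connEvent ends a₁ a₂)ᶜ) *
            prob p₀ (connEvent ends a₁ a₃ ∩ connEvent ends a₂ o ∩ (connEvent ends a₁ a₂)ᶜ)) -
        Dqo p₀ ends o a₁ a₂ *
          (prob p₀ (connEvent ends a₁ a₂)ᶜ *
            prob p₀ (connEvent ends a₂ b ∩ connEvent ends a₁ a₃ ∩ (connEvent ends a₁ a₂)ᶜ) -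
          prob p₀ (connEvent ends a₂ b ∩ (connEvent ends a₁ a₂)ᶜ) *
            prob p₀ (connEvent ends a₁ a₃ ∩ (connEvent ends a₁ a₂)ᶜ))) +
      (prob p₀ (connEvent ends a₁ a₂)ᶜ * prob p₁ (connEvent ends a₂ b ∩ (connEvent ends a₁ a₂)ᶜ) -
        prob p₁ (connEvent ends a₁ a₂)ᶜ * prob p₀ (connEvent ends a₂ b ∩ (connEvent ends a₁ a₂)ᶜ)) *
      (Dqo p₀ ends o a₁ a₂ * prob p₀ (connEvent ends a₁ a₃ ∩ (connEvent ends a₁ a₂)ᶜ) -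
        prob p₀ (connEvent ends a₁ a₂)ᶜ *
          prob p₀ (connEvent ends a₁ a₃ ∩ connEvent ends a₂ o ∩ (connEvent ends a₁ a₂)ᶜ)) := by
    rw [hT]; ring
  rcases eq_or_lt_of_le hX0 with hX0' | hX0'
  · have hz : ∀ Y : Set (Config E), Y ⊆ (connEvent ends a₁ a₂)ᶜ → prob p₀ Y = 0 := fun Y hY =>
      le_antisymm (by rw [hX0']; exact prob_mono hp0 hY) (prob_nonneg hp0 Y)
    have z4 : prob p₀ (connEvent ends a₂ b ∩ connEvent ends a₁ a₃ ∩ connEvent ends a₂ o ∩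
        (connEvent ends a₁ a₂)ᶜ) = 0 := hz _ (fun _ h => h.2)
    have z3 : prob p₀ (connEvent ends a₁ a₃ ∩ connEvent ends a₂ o ∩ (connEvent ends a₁ a₂)ᶜ) = 0 :=
      hz _ (fun _ h => h.2)
    have z2 : prob p₀ (connEvent ends a₂ b ∩ connEvent ends a₁ a₃ ∩ (connEvent ends a₁ a₂)ᶜ) = 0 :=
      hz _ (fun _ h => h.2)
    have z1 : prob p₀ (connEvent ends a₁ a₃ ∩ (connEvent ends a₁ a₂)ᶜ) = 0 := hz _ (fun _ h => h.2)
    rw [hT, z4, z3, z2, z1]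
    simp
  · have hprod := mul_nonneg hsign (sub_nonneg.mpr hodds)
    have hrhs := add_nonneg (mul_nonneg hX1 hQ) hprod
    rw [← key] at hrhs
    exact nonneg_of_mul_nonneg_right hrhs hX0'

end QB

end CaseOne

end Summit.Ventures.PercRepro2
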